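import Summits.Ventures.LatticeQCDFlow.Scaling.FiniteOddsLumpedLaw

/-!
HONEST FRAMING: exact (Metropolis-corrected) sampling algorithms for lattice gauge theory; figures
of merit are autocorrelation/cost numbers at stated couplings and volumes; no continuum-physics
claim.

# FiniteOddsNonMonotone — THE FINITE-ODDS REDUCTION AND THE CONDITIONAL LAW WITHOUT THE MONOTONICITY OF THE TAIL COUPLING: THE CRITERION BECOMES
# `ρΔΦ ≤ σ·[G̃(Φ+e) − 2D̃⁺ + pΔ(2E_{μ_1}θ − E_ũXWθ − E_ũYWθ)]` WITH `D̃⁺ = E_q̃(Δ − Δ')⁺` (`= G̃` FOR MONOTONE COUPLINGS), SO THE OPTIMAL COUPLING OF THE TAIL LAWS CAN BE USED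
# WITHOUT PROVING IT MONOTONE (lean-2 GEN-36, ours)

Venture-side (OURS).  Cell `lqcd-flow` (pub-lqcd), unit `pub-lqcd-lean-2-g36`, 2026-08-29.  Chapter W (item 1 (i) at finite swap odds), file 11.  Files 5–7 assumed the tail coupling
`q̃` monotone on its support (`Δ' ≤ Δ`); the toy finds the optimal coupling monotone in every state, but that is not proved, and the synchronous pair kernel of file 9 is NOT monotone
in general.  Chapter V file 5's general bracket carries the term `2r_max·D⁺`, `D⁺ = E(Δ − Δ')⁺ = G + P(Δ' > Δ)`; keeping it, the mixture reduction of file 5 reads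
`ρΔΦ + (1−σ)Δ(e−2r_z) ≤ σ[G̃(Φ+e) − 2r_maxD̃⁺ + Δ(R̃_X+R̃_Y−e)]` (`mixtureGen_product_contract`), with the `σ`-discounted hub weight `ρΔΦ ≤ σ[G̃(Φ+e) − 2r_maxD̃⁺ + Δ(R̃_X+R̃_Y−2r̄)]`,
in persistence form `ρΔΦ ≤ σ[G̃(Φ+e) − 2D̃⁺ + pΔ(2Σμ_0Wθ − E_ũXWθ − E_ũYWθ)]` (`finiteOddsGen_persistence_contract`), and the conditional law of file 7 holds with this hypothesis for
ANY family of couplings of the tail laws (`finiteOddsGen_lumped_worstTvDist_le`, any constant `c ≥ 1`).  Hypothesis-equations, no definitions.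

## What is proved

* **`mixtureGen_product_contract`**, **`finiteOddsGen_persistence_contract`**, **`finiteOddsGen_lumped_worstTvDist_le`**.

Reading (no numerics implied): for a monotone `q̃`, `D̃⁺ = G̃` and everything reduces to files 5–7; for the optimal coupling `D̃⁺ = G̃ + P(Δ' = Δ+1)`.  NOT CLAIMED: any bound.
Literature grade (cell rule): OWN, elementary; nothing cited as a fact; no new bib keys.
-/

open Finset Matrix
open Literature.Probability.MarkovChains

namespace Summit.Ventures.LatticeQCDFlow.Scaling

section MixtureGen
variable {S : Type*} [Fintype S] [DecidableEq S]
variable {σ : ℝ} {z : S} {utX utY : S → ℝ} {qt q : S → S → ℝ} {Dn : S → S → ℝ} {r : S → ℝ} {D Φ e rmax ρ : ℝ}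

/-- **The product criterion at swap odds `σ` for ANY coupling of the tail laws:** with `D̃⁺ = Σq̃·(Δ−Δ')⁺`, if
`ρΔΦ + (1−σ)Δ(e − 2r_z) ≤ σ·[G̃(Φ+e) − 2r_maxD̃⁺ + Δ(R̃_X + R̃_Y − e)]` then `E_q[Δ'Φ'] ≤ (1−ρ)ΔΦ` for `q = (1−σ)δ_(z,z) + σq̃` (`0 ≤ r ≤ r_max`, `0 ≤ σ`). [ours] -/
theorem mixtureGen_product_contract (hσ0 : 0 ≤ σ) (hqt : IsCoupling utX utY qt)
    (hq : ∀ a b, q a b = (1 - σ) * ((if a = z then (1 : ℝ) else 0) * (if b = z then (1 : ℝ) else 0)) + σ * qt a b)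
    (hDz : Dn z z = D) (hr0 : ∀ v, 0 ≤ r v) (hrmax : ∀ v, r v ≤ rmax)
    (hcrit : ρ * D * Φ + (1 - σ) * D * (e - 2 * r z)
      ≤ σ * ((D - ∑ a, ∑ b, qt a b * Dn a b) * (Φ + e) - 2 * rmax * ∑ a, ∑ b, qt a b * max (D - Dn a b) 0
              + D * (∑ a, utX a * r a + ∑ b, utY b * r b - e))) :
    ∑ a, ∑ b, q a b * (Dn a b * (Φ + e - r a - r b)) ≤ (1 - ρ) * D * Φ := by
  rw [mixture_product_split hq hDz]
  have hb := product_bracket_le qt Dn utX utY r D Φ e rmax hqt.1 hqt.2.1 hqt.2.2 hr0 hrmax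
  have hb' := mul_le_mul_of_nonneg_left hb hσ0
  nlinarith

end MixtureGen

section PersistenceGen
variable {S : Type*} [Fintype S] [DecidableEq S]
variable {W θ μ0 : S → ℝ} {p σ : ℝ} {z : S} {utX utY : S → ℝ} {qt q : S → S → ℝ} {Dn : S → S → ℝ} {D Φ e ρ : ℝ}

/-- **The persistence form for ANY coupling of the tail laws:** `θ = 1/(1+pW)`, `e = 2(1−σ)θ_z + 2σθ̄`; if
`ρΔΦ ≤ σ·[G̃(Φ+e) − 2D̃⁺ + pΔ(2Σμ_0Wθ − E_ũXWθ − E_ũYWθ)]` then `E_q[Δ'Φ'] ≤ (1−ρ)ΔΦ`. [ours] -/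
theorem finiteOddsGen_persistence_contract (hW : ∀ v, 0 < W v) (hp0 : 0 ≤ p) (hp : ∀ v, p * W v ≤ 1) (hθ : ∀ v, θ v = 1 / (1 + p * W v))
    (hμ1 : ∑ v, μ0 v = 1) (hσ0 : 0 ≤ σ) (hqt : IsCoupling utX utY qt) (hutX : ∑ a, utX a = 1) (hutY : ∑ b, utY b = 1)
    (hq : ∀ a b, q a b = (1 - σ) * ((if a = z then (1 : ℝ) else 0) * (if b = z then (1 : ℝ) else 0)) + σ * qt a b)
    (hDz : Dn z z = D) (he : e = 2 * (1 - σ) * θ z + 2 * σ * ∑ v, μ0 v * θ v)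
    (hcrit : ρ * D * Φ ≤ σ * ((D - ∑ a, ∑ b, qt a b * Dn a b) * (Φ + e) - 2 * ∑ a, ∑ b, qt a b * max (D - Dn a b) 0
        + p * D * (2 * ∑ v, μ0 v * (W v * θ v) - ∑ a, utX a * (W a * θ a) - ∑ b, utY b * (W b * θ b)))) :
    ∑ a, ∑ b, q a b * (Dn a b * (Φ + e - θ a - θ b)) ≤ (1 - ρ) * D * Φ := by
  subst he
  refine mixtureGen_product_contract (rmax := 1) hσ0 hqt hq hDz (fun v => (by have := (theta_mem hW hp0 hp hθ v).1; linarith)) (fun v => (theta_mem hW hp0 hp hθ v).2) ?_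
  rw [persist_expect hW hp0 hθ utX, persist_expect hW hp0 hθ utY, hutX, hutY]
  have hf := persist_fresh hW hp0 hθ hμ1
  rw [hf] at hcrit ⊢
  -- the two sides differ by the same polynomial identity as in file 6
  have e1 : σ * ((D - ∑ a, ∑ b, qt a b * Dn a b) * (Φ + (2 * (1 - σ) * θ z + 2 * σ * (1 - p * ∑ v, μ0 v * (W v * θ v))))
        - 2 * 1 * ∑ a, ∑ b, qt a b * max (D - Dn a b) 0
        + D * (1 - p * ∑ v, utX v * (W v * θ v) + (1 - p * ∑ v, utY v * (W v * θ v)) - (2 * (1 - σ) * θ z + 2 * σ * (1 - p * ∑ v, μ0 v * (W v * θ v)))))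
      - (ρ * D * Φ + (1 - σ) * D * ((2 * (1 - σ) * θ z + 2 * σ * (1 - p * ∑ v, μ0 v * (W v * θ v))) - 2 * θ z))
      = σ * ((D - ∑ a, ∑ b, qt a b * Dn a b) * (Φ + (2 * (1 - σ) * θ z + 2 * σ * (1 - p * ∑ v, μ0 v * (W v * θ v))))
        - 2 * ∑ a, ∑ b, qt a b * max (D - Dn a b) 0
        + p * D * (2 * ∑ v, μ0 v * (W v * θ v) - ∑ a, utX a * (W a * θ a) - ∑ b, utY b * (W b * θ b)))
      - ρ * D * Φ := by ring
  linarith [hcrit, e1]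

end PersistenceGen

section LumpedGen
variable {X : Type*} [Fintype X] [DecidableEq X] {S : Type*} [Fintype S] [DecidableEq S]
variable {hub : X → S} {comp : X → S → ℕ} {K : ℕ} {μ0 W θ : S → ℝ} {p σ ρ C c : ℝ} {acc : S → S → ℝ} {Kh : (S → ℕ) → S → S → ℝ}
variable {u ut : X → S → ℝ} {qt q : X → X → S → S → ℝ}
variable {P : X → X → ℝ} {Q : Matrix (X × X) (X × X) ℝ} {Δ : (S → ℕ) → (S → ℕ) → ℕ} {F Ψ : X × X → ℝ}

/-- **THE CONDITIONAL LAW AT SWAP ODDS `σ` FOR ANY FAMILY OF TAIL COUPLINGS** (no monotonicity): file 7's `finiteOdds_lumped_worstTvDist_le` with the persistence inequality carrying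
`G̃(Φ+e) − 2D̃⁺` in place of `G̃(Φ+e−2)`. [ours] -/
theorem finiteOddsGen_lumped_worstTvDist_le [Nonempty X] (hinj : ∀ x x', hub x = hub x' → comp x = comp x' → x = x') (hsum : ∀ x, ∑ v, comp x v = K + 1)
    (hsurj : ∀ (z : S) (N : S → ℕ), ∑ v, N v = K + 1 → N z ≠ 0 → ∃ x, hub x = z ∧ comp x = N) (hhub : ∀ x, comp x (hub x) ≠ 0) (hK : 1 ≤ K)
    (hW : ∀ v, 0 < W v) (hp0 : 0 ≤ p) (hp : ∀ v, p * W v ≤ 1) (hθ : ∀ v, θ v = 1 / (1 + p * W v)) (hacc : ∀ h v, acc h v = min 1 (W h / W v))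
    (hμ0 : ∀ v, 0 ≤ μ0 v) (hμ1 : ∑ v, μ0 v = 1) (hc1 : 1 ≤ c) (hσ0 : 0 ≤ σ) (hσ1 : σ < 1) (hρ0 : 0 ≤ ρ) (hρ : ρ ≤ 1 / 2)
    (hKoff : ∀ N h v, h ≠ v → Kh N h v = if N h = 0 then 0 else (N v : ℝ) / K * acc h v) (hKdiag : ∀ N h, Kh N h h = 1 - ∑ v ∈ univ.erase h, Kh N h v)
    (hu : ∀ x v, u x v = (1 - σ) * (if v = hub x then (1 : ℝ) else 0) + σ * ∑ h, u x h * Kh (comp x) h v)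
    (hut : ∀ x v, ut x v = ∑ h, u x h * Kh (comp x) h v)
    (hqtc : ∀ x y, IsCoupling (ut x) (ut y) (qt x y))
    (hq : ∀ x y a b, q x y a b = (1 - σ) * ((if a = hub x then (1 : ℝ) else 0) * (if b = hub y then (1 : ℝ) else 0)) + σ * qt x y a b)
    (hΔ : ∀ N N', Δ N N' = ∑ v, (N v - N' v))
    (hP : ∀ x x', P x x' = ∑ a, u x a * (μ0 (hub x') * (if comp x' + Pi.single a 1 = comp x + Pi.single (hub x') 1 then (1 : ℝ) else 0)))
    (hQ : ∀ x y x' y', Q (x, y) (x', y') = ∑ a, ∑ b, q x y a b * (μ0 (hub x')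
      * (if comp x' + Pi.single a 1 = comp x + Pi.single (hub x') 1 then (1 : ℝ) else 0))
      * ((if hub y' = hub x' then (1 : ℝ) else 0) * (if comp y' + Pi.single b 1 = comp y + Pi.single (hub y') 1 then (1 : ℝ) else 0)))
    (hF : ∀ x y, F (x, y) = c + (-(1 - σ) * θ (hub x)) + (-(1 - σ) * θ (hub y)) + ∑ v, θ v * ((comp x v : ℝ) + (comp y v : ℝ)))
    (hC : C = 2 * ((K + 1) * (c + 2 * K + 6)))
    (hΨ : ∀ x y, Ψ (x, y) = (Δ (comp x) (comp y) : ℝ) * F (x, y) + C * (if hub x = hub y then (0 : ℝ) else 1))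
    (hpers : ∀ x y, hub x = hub y →
      ρ * (Δ (comp x) (comp y) : ℝ) * F (x, y)
        ≤ σ * (((Δ (comp x) (comp y) : ℝ) - ∑ a, ∑ b, qt x y a b * (Δ (comp x - Pi.single a 1) (comp y - Pi.single b 1) : ℝ))
              * (F (x, y) + (2 * (1 - σ) * θ (hub x) + 2 * σ * ∑ v, μ0 v * θ v))
            - 2 * ∑ a, ∑ b, qt x y a b * max ((Δ (comp x) (comp y) : ℝ) - (Δ (comp x - Pi.single a 1) (comp y - Pi.single b 1) : ℝ)) 0
            + p * (Δ (comp x) (comp y) : ℝ) * (2 * ∑ v, μ0 v * (W v * θ v) - ∑ a, ut x a * (W a * θ a) - ∑ b, ut y b * (W b * θ b))))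
    {π : X → ℝ} (hπ : IsStationary π P) (hπ0 : ∀ x, 0 ≤ π x) (hπ1 : ∑ x, π x = 1) (n : ℕ) :
    worstTvDist P π n ≤ ((K + 1) * (c + 2 * K + 2) + 2 * ((K + 1) * (c + 2 * K + 6))) * (1 - ρ) ^ n := by
  have hu0 : ∀ x a, 0 ≤ u x a := finiteOdds_endHub_nonneg hW hacc hKoff hKdiag hK hsum hσ0 hσ1 hu
  have hu1 : ∀ x, ∑ a, u x a = 1 := finiteOdds_endHub_sum hKdiag hσ1 hu
  have hlegal : ∀ x a, u x a ≠ 0 → comp x a ≠ 0 := finiteOdds_endHub_legal hW hacc hKoff hKdiag hK hsum hhub hσ0 hσ1 hu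
  have hut1 : ∀ x, ∑ v, ut x v = 1 := finiteOdds_tail_sum hKdiag hσ1 hu hut
  have hdec : ∀ x v, u x v = (1 - σ) * (if v = hub x then (1 : ℝ) else 0) + σ * ut x v := fun x v => geomResolvent_decomp (hu x) (hut x) v
  have hqc : ∀ x y, IsCoupling (u x) (u y) (q x y) := fun x y => mixture2_isCoupling hσ0 hσ1.le (hqtc x y) (hdec x) (hdec y) (hq x y)
  have hF1 : ∀ x y, 1 ≤ F (x, y) := fun x y => by linarith [finiteOdds_F_ge hW hp0 hp hθ hσ0 hhub hF x y]
  have hFmax : ∀ x y, F (x, y) ≤ c + 2 * K + 2 := finiteOdds_F_le hW hp0 hp hθ hσ1 hsum hF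
  have hK0 : (0 : ℝ) ≤ K := Nat.cast_nonneg _
  have hC1 : 1 ≤ C := by rw [hC]; nlinarith
  have hc0 : 0 ≤ c := by linarith
  have hBC : ((K : ℝ) + 1) * (c + 2 * K + 6) ≤ (1 - ρ) * C := by rw [hC]; nlinarith
  have hcrit : ∀ x y, hub x = hub y → ∑ a, ∑ b, q x y a b * ((Δ (comp x - Pi.single a 1) (comp y - Pi.single b 1) : ℝ)
        * (F (x, y) + (2 * ∑ v, μ0 v * (-(1 - σ) * θ v) - (-(1 - σ) * θ (hub x)) - (-(1 - σ) * θ (hub y)) + 2 * ∑ v, μ0 v * θ v) - θ a - θ b))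
        ≤ (1 - ρ) * ((Δ (comp x) (comp y) : ℝ) * F (x, y)) := by
    intro x y hxy
    rw [hxy, finiteOdds_e_eq]
    have hz : comp x (hub y) ≠ 0 := hxy ▸ hhub x
    have hDz : (Δ (comp x - Pi.single (hub y) 1) (comp y - Pi.single (hub y) 1) : ℝ) = (Δ (comp x) (comp y) : ℝ) := by
      have ex := urnChain_survivor (comp x) hz
      have ey := urnChain_survivor (comp y) (hhub y)
      have h := cdist_add_single_same hΔ (comp x - Pi.single (hub y) 1) (comp y - Pi.single (hub y) 1) (hub y)
      rw [← ex, ← ey] at h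
      exact_mod_cast h.symm
    have h := finiteOddsGen_persistence_contract (z := hub y) (utX := ut x) (utY := ut y) (qt := qt x y) (q := q x y)
      (Dn := fun a b => (Δ (comp x - Pi.single a 1) (comp y - Pi.single b 1) : ℝ)) (D := (Δ (comp x) (comp y) : ℝ)) (Φ := F (x, y))
      (e := 2 * (1 - σ) * θ (hub y) + 2 * σ * ∑ v, μ0 v * θ v) (ρ := ρ)
      hW hp0 hp hθ hμ1 hσ0 (hqtc x y) (hut1 x) (hut1 y) (fun a b => by rw [hq x y a b, hxy]) hDz rfl
      (by have := hpers x y hxy; rw [hxy] at this; exact this)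
    calc _ = ∑ a, ∑ b, q x y a b * ((Δ (comp x - Pi.single a 1) (comp y - Pi.single b 1) : ℝ)
            * (F (x, y) + (2 * (1 - σ) * θ (hub y) + 2 * σ * ∑ v, μ0 v * θ v) - θ a - θ b)) := rfl
      _ ≤ (1 - ρ) * (Δ (comp x) (comp y) : ℝ) * F (x, y) := h
      _ = (1 - ρ) * ((Δ (comp x) (comp y) : ℝ) * F (x, y)) := by ring
  have h := lumpedAny_worstTvDist_le (c := c) (s := fun v => -(1 - σ) * θ v) (r := θ) (C := C) (Fmax := c + 2 * K + 2) hinj hsum hsurj hμ0 hμ1 hlegal hqc hΔ hP hQ hF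
    hΨ hF1 hFmax hC1 (by linarith) hBC (finiteOdds_functional_le hW hp0 hp hθ hc0 hσ0 hσ1 hμ0 hμ1 hΔ hsum hqc hu1 hF) hcrit hπ hπ0 hπ1 n
  rw [hC] at h
  exact h

end LumpedGen

end Summit.Ventures.LatticeQCDFlow.Scaling
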